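import Literature.RingTheory.KTheory.RatFuncPrimeTameSymbols
import Literature.RingTheory.KTheory.RatFuncLeadingCoeffSymbol
import HarnessLib

/-!
# The filtration `L₀ ⊂ L₁ ⊂ L₂ ⊂ ⋯` of `K₂F(t)` by degree and Lemmas 2.4, 2.5 of Milnor 1970
# (Milnor, *Algebraic K-theory and quadratic forms*, §2; Milnor's book §11, «the technique used to compute K₂Q»)

Family `hodge`, lane `lit-hodgefound` (foundations library; seat `lit-hodgefound-p27`, generation 39, row g39-#5);
topic `RingTheory/KTheory`.  Third file of the MILNOR–TATE theorem `K₂F(t) ≅ K₂F ⊕ ⊕_𝔭 (F[t]/𝔭)•`, at the level of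
the universal symbol group `U(F(t))` (`UniversalSymbolGroup`, g30-#1; `≅ K₂F(t)` by `matsumotoEquiv`, g38-#10).
Sequel of `RatFuncPrimeTameSymbols` (g39-#4: `monicGen`, `primeDeg`, `polyUnit`, `residueClassUnit`, the tame
symbols of `c(g, π)`) and `RatFuncLeadingCoeffSymbol` (g39-#3: `lcSymbolHom`, `constSymbolHom`).  DEFINITIONS WITH
BODIES (`polyUnitsBelow`, `symbolsBelow`, `filtration`, `topSymbols`, `topPart`, `hRep`, `hSymbol`, `hMap`,
`atomsBelow`) and PROVED THEOREMS; no named fact, no instance, no notation, 0 `sorry`, net debt 0 (D-0026).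

## The source, verbatim

J. Milnor, *Algebraic K-theory and quadratic forms*, Invent. Math. 9 (1970) 318–344 (held
`paper:doi-10-1007-bf01425486`; bib key `Milnor1970`), §2 (p0008 L16 – p0010 L8):
«Proof. Keeping n fixed, let L_d ⊂ K_nF(t) be the subgroup generated by those products l(f₁)⋯l(f_n) such that
f₁, …, f_n ∈ F[t] are polynomials of degree ≤ d. Thus L₀ ⊂ L₁ ⊂ L₂ ⊂ … with union K_nF(t). […] Let π be a monic
irreducible polynomial of degree d. Then each element ḡ of the quotient F[t]/(π) is represented by a unique polynomial
g ∈ F[t] of degree < d. **LEMMA 2.4.** There exists one and only one homomorphism h_π : K_{n−1}F[t]/(π) → L_d/L_{d−1}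
which carries each product l(ḡ₂)⋯l(ḡ_n) to the residue class of l(π)l(g₂)⋯l(g_n) modulo L_{d−1}. *Proof.* […]
Suppose that ḡ₂ = ḡ₂′ḡ₂″ mod (π), where g₂, g₂′, g₂″ are polynomials of degree < d. Then g₂ = πf + g₂′g₂″ where f is
also a polynomial of degree < d. Hence, if f ≠ 0, 1 = πf/g₂ + g₂′g₂″/g₂ and therefore
(l(π) + l(f) − l(g₂))(l(g₂′) + l(g₂″) − l(g₂)) = 0. Multiplying […] and then reducing modulo L_{d−1}, we obtain
l(π)(l(g₂′) + l(g₂″) − l(g₂)) […] = 0. Since the case f = 0 is straightforward, this proves that our correspondence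
is linear. […] **LEMMA 2.5.** The homomorphisms ∂_π give rise to an isomorphism between L_d/L_{d−1} and the direct
sum of K_{n−1}F[t]/(π) as π ranges over monic irreducible polynomials of degree d. *Proof.* […] we need only to show
that L_d/L_{d−1} is generated by the images of the h_π. Consider any generator of L_d, expressed as a product
l(f₁)⋯l(f_s)l(g_{s+1})⋯l(g_n) where f₁, …, f_s have degree d and g_{s+1}, …, g_n have degree < d. If s ≥ 2 then we
can set f₂ = −af₁ + g with a ∈ F• and degree g < d. If g ≠ 0 it follows that af₁/g + f₂/g = 1 hence
(l(a) + l(f₁) − l(g))(l(f₂) − l(g)) = 0. Thus the product l(f₁)l(f₂) can be expressed as a sum of terms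
l(f₁)l(g) + l(g)l(f₂) − l(a)l(f₂) + l(a)l(g) − l(g)², each of which involves at most one polynomial of degree d.
[…] It follows, by induction on s, that every element of L_d can be expressed, modulo L_{d−1}, in terms of products
l(f₁)l(g₂)⋯l(g_n) where only f₁ has degree d. If f₁ is irreducible, then setting f₁ = aπ this product evidently
belongs to the image of h_π. But if f₁ is reducible then the product is congruent to zero modulo L_{d−1}. Thus
L_d/L_{d−1} is generated by the images of the homomorphisms h_π.»

(Milnor's book, §11 Remark, chunk p0069 L52–L53: «The technique used above to compute K₂Q can also be applied to
K₂F(x)»; the filtration is that of the proof of Theorem 11.6, chunk p0067 L16–L21.)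

## What is formalised (`n = 2`, written multiplicatively in `U = U(F(t))`, `c = univSymbol`)

* §1 «L_d ⊂ K_nF(t) … generated by those products … of degree ≤ d»: `polyUnitsBelow d`, `symbolsBelow d`,
  **`filtration F d = L_d`** (`filtration_mono`, `univSymbol_mem_filtration(_of_mem_closure)`), the general
  `IsSteinbergSymbol.mem_of_mem_closure`, «with union K_nF(t)»: `exists_mem_closure_polyUnitsBelow`,
  **`exists_mem_filtration`**, `iSup_filtration_eq_top`; and `filtration_zero_le_range_constSymbolHom` (`L₀ ⊆ K₂F`).
* §2 **LEMMA 2.4**: the generators `topSymbols (d+1) = {c(π, g) : deg π = d+1, deg g ≤ d}` and `topPart`, the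
  linearity **`univSymbol_monicGen_linear_mem_filtration`** («g₂ = πf + g₂′g₂″ … 1 = πf/g₂ + g₂′g₂″/g₂»), the
  representative `hRep` of degree `< d+1`, `hSymbol`, and the homomorphism
  **`hMap v : (F[t]/π)• →* U/L_d`** with **`hMap_residueClassUnit`** (`h_π(ḡ) = [c(π, g)]` for ANY representative
  of degree `≤ d`).
* §3 **LEMMA 2.5, generation half**: the atoms `atomsBelow e` (constants and monic irreducibles of degree `≤ e`),
  `polyUnit_mem_closure_atomsBelow` (unique factorisation), the five-term identity
  `univSymbol_monic_irreducible_mem` («f₂ = −af₁ + g … l(f₁)l(g) + l(g)l(f₂) − l(a)l(f₂) + l(a)l(g) − l(g)²», here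
  for two distinct monic irreducibles of degree `d+1`), `univSymbol_atoms_mem`, and
  **`filtration_succ_le : L_{d+1} ≤ L_d ⊔ topPart (d+1)`** / `filtration_succ_eq`.
* §4 «Inspection shows that each ∂_π induces a homomorphism L_d/L_{d−1} → K_{n−1}F[t]/(π)»:
  **`tameHomQuot_apply_eq_one_of_mem_filtration`** (`∂_𝔭(L_d) = 1` for `deg 𝔭 > d`),
  `tameHomQuot_hGenerator_self/of_ne` (`∂_𝔭 c(π_𝔭, g) = ḡ⁻¹`, `∂_{𝔭′} c(π_𝔭, g) = 1`), and
  `lcSymbolHom_eq_one_of_mem_topPart` (the leading-coefficient symbol kills `c(π, g)`, `π` monic).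

The isomorphism of Lemma 2.5 and Theorem 2.3 itself are assembled in the sequel `KTwoRatFuncMilnorTate` (g39-#6).

## References

* [Milnor1970] J. Milnor, *Algebraic K-theory and quadratic forms*, Invent. Math. 9 (1970) 318–344 — §2 Theorem 2.3,
  Lemma 2.4, Lemma 2.5 (p0008 L16 – p0010 L8).
* [Milnor1972] J. Milnor, *Introduction to Algebraic K-Theory*, Annals of Mathematics Studies 72, Princeton University
  Press (1971) — §11 Remark before Theorem 11.10 (chunk p0069 L45 – p0070 L20), proof of Theorem 11.6 (chunk p0067
  L16–L21).

Provenance: lane `lit-hodgefound`, seat `lit-hodgefound-p27` gen 39 (agent `literature-prover-lit-hodgefound-p27-g39-0`),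
row g39-#5.
-/

set_option autoImplicit false

noncomputable section

namespace Literature.RingTheory.KTheory

open Polynomial IsDedekindDomain

/-! ### §0 A Steinberg symbol on generated subgroups -/

section General

variable {R : Type*} [CommRing R] {A : Type*} [Group A] {c : Rˣ → Rˣ → A}

/-- A Steinberg symbol takes the subgroups generated by `S` and `T` into any subgroup containing all `c(s, t)`,
`s ∈ S`, `t ∈ T` (bimultiplicativity). [cite: Milnor1970, §2 proof of Theorem 2.3 «the subgroup generated by those products» (p0008 L16–L18)] -/
theorem IsSteinbergSymbol.mem_of_mem_closure (hc : IsSteinbergSymbol c) {S T : Set Rˣ} {M : Subgroup A}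
    (h : ∀ s ∈ S, ∀ t ∈ T, c s t ∈ M) {x y : Rˣ} (hx : x ∈ Subgroup.closure S) (hy : y ∈ Subgroup.closure T) :
    c x y ∈ M := by
  have h1 : ∀ t ∈ T, ∀ x ∈ Subgroup.closure S, c x t ∈ M := by
    intro t ht x hx
    have hle : Subgroup.closure S ≤ M.comap (hc.leftHom t) :=
      (Subgroup.closure_le _).2 fun s hs => by rw [SetLike.mem_coe, Subgroup.mem_comap, hc.leftHom_apply]; exact h s hs t ht
    have := hle hx
    rwa [Subgroup.mem_comap, hc.leftHom_apply] at this
  have hle : Subgroup.closure T ≤ M.comap (hc.rightHom x) :=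
    (Subgroup.closure_le _).2 fun t ht => by rw [SetLike.mem_coe, Subgroup.mem_comap, hc.rightHom_apply]; exact h1 t ht x hx
  have := hle hy
  rwa [Subgroup.mem_comap, hc.rightHom_apply] at this

end General

variable (F : Type*) [Field F]

/-! ### §1 «L_d ⊂ K_nF(t), the subgroup generated by l(f₁)l(f₂), deg fᵢ ≤ d» -/

section Filtration

/-- The non-zero polynomials of degree `≤ d`, as units of `F(t)`. [cite: Milnor1970, §2 proof of Theorem 2.3 (p0008 L16–L18)] -/
def polyUnitsBelow (d : ℕ) : Set (RatFunc F)ˣ :=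
  {x | ∃ (g : F[X]) (hg : g ≠ 0), g.natDegree ≤ d ∧ polyUnit F g hg = x}

/-- Membership of a polynomial in `polyUnitsBelow`. [cite: Milnor1970, §2 proof of Theorem 2.3 (p0008 L16–L18)] -/
theorem polyUnit_mem_polyUnitsBelow {d : ℕ} {g : F[X]} (hg : g ≠ 0) (hd : g.natDegree ≤ d) :
    polyUnit F g hg ∈ polyUnitsBelow F d := ⟨g, hg, hd, rfl⟩

/-- `polyUnitsBelow` is increasing in `d`. [cite: Milnor1970, §2 proof of Theorem 2.3 «L₀ ⊂ L₁ ⊂ L₂ ⊂ …» (p0008 L18–L19)] -/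
theorem polyUnitsBelow_mono {d e : ℕ} (h : d ≤ e) : polyUnitsBelow F d ⊆ polyUnitsBelow F e := by
  rintro x ⟨g, hg, hd, rfl⟩
  exact ⟨g, hg, hd.trans h, rfl⟩

/-- The generating symbols `c(f, g)`, `deg f, deg g ≤ d`. [cite: Milnor1970, §2 proof of Theorem 2.3 (p0008 L16–L18)] -/
def symbolsBelow (d : ℕ) : Set (UniversalSymbolGroup (RatFunc F)) :=
  {u | ∃ x ∈ polyUnitsBelow F d, ∃ y ∈ polyUnitsBelow F d, univSymbol x y = u}

/-- **Milnor's `L_d ⊂ K₂F(t)`** (in the universal symbol group `U(F(t)) ≅ K₂F(t)`): the subgroup generated by the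
symbols `c(f, g)` of polynomials of degree `≤ d`. [cite: Milnor1970, §2 proof of Theorem 2.3 (p0008 L16–L18); Milnor1972, §11 proof of Theorem 11.6 «L_m» (chunk p0067 L16–L19)] -/
def filtration (d : ℕ) : Subgroup (UniversalSymbolGroup (RatFunc F)) := Subgroup.closure (symbolsBelow F d)

/-- The generators lie in `L_d`. [cite: Milnor1970, §2 proof of Theorem 2.3 (p0008 L16–L18)] -/
theorem univSymbol_mem_filtration {d : ℕ} {x y : (RatFunc F)ˣ} (hx : x ∈ polyUnitsBelow F d)
    (hy : y ∈ polyUnitsBelow F d) : univSymbol x y ∈ filtration F d :=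
  Subgroup.subset_closure ⟨x, hx, y, hy, rfl⟩

/-- `c(f, g) ∈ L_d` for polynomials `f, g` of degree `≤ d`. [cite: Milnor1970, §2 proof of Theorem 2.3 (p0008 L16–L18)] -/
theorem univSymbol_polyUnit_mem_filtration {d : ℕ} {f g : F[X]} (hf : f ≠ 0) (hg : g ≠ 0) (hdf : f.natDegree ≤ d)
    (hdg : g.natDegree ≤ d) : univSymbol (polyUnit F f hf) (polyUnit F g hg) ∈ filtration F d :=
  univSymbol_mem_filtration F (polyUnit_mem_polyUnitsBelow F hf hdf) (polyUnit_mem_polyUnitsBelow F hg hdg)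

/-- **«L₀ ⊂ L₁ ⊂ L₂ ⊂ …»**. [cite: Milnor1970, §2 proof of Theorem 2.3 (p0008 L18–L19)] -/
theorem filtration_mono : Monotone (filtration F) := fun _ _ h =>
  Subgroup.closure_mono (by
    rintro u ⟨x, hx, y, hy, rfl⟩
    exact ⟨x, polyUnitsBelow_mono F h hx, y, polyUnitsBelow_mono F h hy, rfl⟩)

/-- `L_d` contains `c(x, y)` for `x, y` in the group generated by the polynomials of degree `≤ d` (quotients included).
[cite: Milnor1970, §2 proof of Theorem 2.3 (p0008 L16–L18)] -/
theorem univSymbol_mem_filtration_of_mem_closure {d : ℕ} {x y : (RatFunc F)ˣ}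
    (hx : x ∈ Subgroup.closure (polyUnitsBelow F d)) (hy : y ∈ Subgroup.closure (polyUnitsBelow F d)) :
    univSymbol x y ∈ filtration F d :=
  (isSteinbergSymbol_univSymbol (R := RatFunc F)).mem_of_mem_closure
    (fun _ hs _ ht => univSymbol_mem_filtration F hs ht) hx hy

/-- Every unit of `F(t)` is a quotient of polynomials of bounded degree. [cite: Milnor1970, §2 proof of Theorem 2.3 «with union K_nF(t)» (p0008 L18–L19)] -/
theorem exists_mem_closure_polyUnitsBelow (x : (RatFunc F)ˣ) : ∃ d : ℕ, x ∈ Subgroup.closure (polyUnitsBelow F d) := by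
  have hnum : (x : RatFunc F).num ≠ 0 := RatFunc.num_ne_zero x.ne_zero
  have hden : (x : RatFunc F).denom ≠ 0 := RatFunc.denom_ne_zero _
  refine ⟨max (x : RatFunc F).num.natDegree (x : RatFunc F).denom.natDegree, ?_⟩
  have hx : x = polyUnit F _ hnum * (polyUnit F _ hden)⁻¹ :=
    Units.ext (by rw [Units.val_mul, Units.val_inv_eq_inv_val, coe_polyUnit, coe_polyUnit, ← div_eq_mul_inv,
      RatFunc.num_div_denom])
  have hmem : polyUnit F _ hnum * (polyUnit F _ hden)⁻¹ ∈
      Subgroup.closure (polyUnitsBelow F (max (x : RatFunc F).num.natDegree (x : RatFunc F).denom.natDegree)) :=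
    mul_mem (Subgroup.subset_closure (polyUnit_mem_polyUnitsBelow F hnum (le_max_left _ _)))
      (inv_mem (Subgroup.subset_closure (polyUnit_mem_polyUnitsBelow F hden (le_max_right _ _))))
  rwa [← hx] at hmem

/-- Every symbol `c(x, y)` lies in some `L_d`. [cite: Milnor1970, §2 proof of Theorem 2.3 «with union K_nF(t)» (p0008 L18–L19)] -/
theorem exists_univSymbol_mem_filtration (x y : (RatFunc F)ˣ) : ∃ d : ℕ, univSymbol x y ∈ filtration F d := by
  obtain ⟨d₁, h₁⟩ := exists_mem_closure_polyUnitsBelow F x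
  obtain ⟨d₂, h₂⟩ := exists_mem_closure_polyUnitsBelow F y
  exact ⟨max d₁ d₂, univSymbol_mem_filtration_of_mem_closure F
    (Subgroup.closure_mono (polyUnitsBelow_mono F (le_max_left _ _)) h₁)
    (Subgroup.closure_mono (polyUnitsBelow_mono F (le_max_right _ _)) h₂)⟩

/-- **«with union K_nF(t)»**: `⨆_d L_d = U(F(t))`. [cite: Milnor1970, §2 proof of Theorem 2.3 (p0008 L18–L19)] -/
theorem iSup_filtration_eq_top : (⨆ d, filtration F d) = ⊤ := by
  rw [eq_top_iff, ← UniversalSymbolGroup.closure_range_univSymbol, Subgroup.closure_le]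
  rintro u ⟨⟨x, y⟩, rfl⟩
  obtain ⟨d, hd⟩ := exists_univSymbol_mem_filtration F x y
  exact Subgroup.mem_iSup_of_mem d hd

/-- **«with union K_nF(t)»**: every element of `U(F(t))` lies in some `L_d`.
[cite: Milnor1970, §2 proof of Theorem 2.3 (p0008 L18–L19)] -/
theorem exists_mem_filtration (u : UniversalSymbolGroup (RatFunc F)) : ∃ d : ℕ, u ∈ filtration F d := by
  have hu : u ∈ ⨆ d, filtration F d := by rw [iSup_filtration_eq_top]; exact Subgroup.mem_top u
  exact (Subgroup.mem_iSup_of_directed (filtration_mono F).directed_le).1 hu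

/-- A polynomial of degree `0` is a non-zero constant, and its unit is the constant unit of `F(t)`.
[cite: Milnor1970, §2 proof of Theorem 2.3 «L₀ … naturally isomorphic to K_nF» (p0008 L20–L23)] -/
theorem polyUnit_eq_map_of_natDegree_eq_zero {g : F[X]} (hg : g ≠ 0) (hd : g.natDegree = 0) :
    ∃ (a : F) (ha : a ≠ 0), polyUnit F g hg = Units.map (algebraMap F (RatFunc F) : F →* RatFunc F) (Units.mk0 a ha) := by
  have hgC : g = C (g.coeff 0) := eq_C_of_natDegree_eq_zero hd
  have ha : g.coeff 0 ≠ 0 := fun h => hg (by rw [hgC, h, C_0])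
  refine ⟨g.coeff 0, ha, Units.ext ?_⟩
  rw [coe_polyUnit, Units.coe_map, MonoidHom.coe_coe, Units.val_mk0]
  conv_lhs => rw [hgC]
  rw [RatFunc.algebraMap_C, RatFunc.algebraMap_eq_C]

/-- **`L₀ ⊆ K₂F`**: `L₀` lies in the image of `U(F) → U(F(t))`. [cite: Milnor1970, §2 proof of Theorem 2.3 «L₀ is … naturally isomorphic to K_nF» (p0008 L20–L23)] -/
theorem filtration_zero_le_range_constSymbolHom : filtration F 0 ≤ (constSymbolHom F).range := by
  rw [filtration, Subgroup.closure_le]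
  rintro u ⟨x, ⟨f, hf, hdf, rfl⟩, y, ⟨g, hg, hdg, rfl⟩, rfl⟩
  obtain ⟨a, ha, hfa⟩ := polyUnit_eq_map_of_natDegree_eq_zero F hf (Nat.le_zero.1 hdf)
  obtain ⟨b, hb, hgb⟩ := polyUnit_eq_map_of_natDegree_eq_zero F hg (Nat.le_zero.1 hdg)
  exact ⟨univSymbol (Units.mk0 a ha) (Units.mk0 b hb), by rw [constSymbolHom_univSymbol, ← hfa, ← hgb]⟩

end Filtration

/-! ### §2 LEMMA 2.4: `h_π : (F[t]/π)• → L_{d+1}/L_d`, `ḡ ↦ c(π, g)` -/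

section Lemma24

/-- The generators `c(π, g)` with `π` monic irreducible of degree `d`, `g ≠ 0` of degree `< d` («products
l(f₁)l(g₂) … where only f₁ has degree d», «f₁ = aπ»). [cite: Milnor1970, §2 proof of Lemma 2.5 (p0010 L3–L5); Lemma 2.4 (p0008 L28–L32)] -/
def topSymbols (d : ℕ) : Set (UniversalSymbolGroup (RatFunc F)) :=
  {u | ∃ (v : HeightOneSpectrum F[X]) (g : F[X]) (hg : g ≠ 0), primeDeg F v = d ∧ g.natDegree < d ∧
    univSymbol (polyUnit F (monicGen F v) (monicGen_ne_zero F v)) (polyUnit F g hg) = u}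

/-- The subgroup generated by the `c(π, g)`, `deg π = d`, `deg g < d` — «the images of the h_π».
[cite: Milnor1970, §2 proof of Lemma 2.5 (p0010 L6–L8)] -/
def topPart (d : ℕ) : Subgroup (UniversalSymbolGroup (RatFunc F)) := Subgroup.closure (topSymbols F d)

/-- The generators `c(π, g)` lie in `topPart`. [cite: Milnor1970, §2 proof of Lemma 2.5 (p0010 L3–L8)] -/
theorem univSymbol_mem_topPart {d : ℕ} (v : HeightOneSpectrum F[X]) (hv : primeDeg F v = d) {g : F[X]} (hg : g ≠ 0)
    (hd : g.natDegree < d) :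
    univSymbol (polyUnit F (monicGen F v) (monicGen_ne_zero F v)) (polyUnit F g hg) ∈ topPart F d :=
  Subgroup.subset_closure ⟨v, g, hg, hv, hd, rfl⟩

/-- `topPart (d+1) ≤ L_{d+1}`. [cite: Milnor1970, §2 proof of Lemma 2.5 (p0010 L3–L8)] -/
theorem topPart_le_filtration (d : ℕ) : topPart F (d + 1) ≤ filtration F (d + 1) := by
  rw [topPart, Subgroup.closure_le]
  rintro u ⟨v, g, hg, hv, hd, rfl⟩
  exact univSymbol_polyUnit_mem_filtration F _ hg (by rw [← primeDeg, hv]) hd.le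

/-- **LEMMA 2.4, the linearity** («Suppose that ḡ₂ = ḡ₂′ḡ₂″ mod (π), where g₂, g₂′, g₂″ are polynomials of degree
< d. Then g₂ = πf + g₂′g₂″ where f is also a polynomial of degree < d. Hence, if f ≠ 0, 1 = πf/g₂ + g₂′g₂″/g₂ and
therefore … reducing modulo L_{d−1}, we obtain l(π)(l(g₂′) + l(g₂″) − l(g₂)) = 0. … the case f = 0 is
straightforward»): `c(π, g′) c(π, g″) c(π, g)⁻¹ ∈ L_d` for `deg π = d + 1`. [cite: Milnor1970, §2 proof of Lemma 2.4 (p0008 L33 – p0009 L10)] -/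
theorem univSymbol_monicGen_linear_mem_filtration {d : ℕ} (v : HeightOneSpectrum F[X]) (hv : primeDeg F v = d + 1)
    {g g' g'' : F[X]} (hg : g ≠ 0) (hg' : g' ≠ 0) (hg'' : g'' ≠ 0) (hdg : g.natDegree ≤ d) (hdg' : g'.natDegree ≤ d)
    (hdg'' : g''.natDegree ≤ d)
    (hmod : Ideal.Quotient.mk v.asIdeal g = Ideal.Quotient.mk v.asIdeal g' * Ideal.Quotient.mk v.asIdeal g'') :
    univSymbol (polyUnit F (monicGen F v) (monicGen_ne_zero F v)) (polyUnit F g' hg') *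
        univSymbol (polyUnit F (monicGen F v) (monicGen_ne_zero F v)) (polyUnit F g'' hg'') *
        (univSymbol (polyUnit F (monicGen F v) (monicGen_ne_zero F v)) (polyUnit F g hg))⁻¹ ∈ filtration F d := by
  have hSt := isSteinbergSymbol_univSymbol (R := RatFunc F)
  set π : F[X] := monicGen F v with hπdef
  have hπ0 : π ≠ 0 := monicGen_ne_zero F v
  -- `g − g′g″ = π f`
  have hdvd : π ∣ g - g' * g'' := by
    rw [hπdef, ← mem_iff_monicGen_dvd, ← Ideal.Quotient.eq, hmod, map_mul]
  obtain ⟨f, hf⟩ := hdvd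
  by_cases hf0 : f = 0
  · -- «the case f = 0 is straightforward»: `g = g′g″`
    have hgeq : g = g' * g'' := by rw [hf0, mul_zero, sub_eq_zero] at hf; exact hf
    have hunit : polyUnit F g hg = polyUnit F g' hg' * polyUnit F g'' hg'' := by
      rw [← polyUnit_mul]; exact Units.ext (by simp only [coe_polyUnit, hgeq])
    rw [hunit, hSt.mul_right, mul_inv_cancel]
    exact one_mem _
  · -- `deg f ≤ d − 1`
    have hdf : f.natDegree ≤ d := by
      have h1 : (π * f).natDegree = (d + 1) + f.natDegree := by rw [natDegree_mul hπ0 hf0, ← hv, primeDeg]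
      have h2 : (g - g' * g'').natDegree ≤ max g.natDegree (g' * g'').natDegree := natDegree_sub_le _ _
      have h3 : (g' * g'').natDegree ≤ d + d := natDegree_mul_le.trans (add_le_add hdg' hdg'')
      rw [hf] at h2
      omega
    -- the units `A = π f / g`, `B = g′ g″ / g`, with `A + B = 1`
    set A : (RatFunc F)ˣ := polyUnit F π hπ0 * (polyUnit F f hf0 * (polyUnit F g hg)⁻¹) with hA
    set B : (RatFunc F)ˣ := polyUnit F g' hg' * polyUnit F g'' hg'' * (polyUnit F g hg)⁻¹ with hB
    have hga : algebraMap F[X] (RatFunc F) g ≠ 0 := (polyUnit F g hg).ne_zero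
    have hAB : (A : RatFunc F) + B = 1 := by
      have hgsum : g = π * f + g' * g'' := by rw [← hf]; ring
      rw [hA, hB]
      simp only [Units.val_mul, Units.val_inv_eq_inv_val, coe_polyUnit]
      rw [← mul_assoc, ← add_mul, ← map_mul, ← map_mul, ← map_add, ← hgsum, mul_inv_cancel₀ hga]
    have hone : univSymbol A B = 1 := hSt.eq_one_of_add_eq_one A B hAB
    -- `c(A, B) = c(π, B) · c(f/g, B)` and `c(f/g, B) ∈ L_d`
    have hfg : univSymbol (polyUnit F f hf0 * (polyUnit F g hg)⁻¹) B ∈ filtration F d := by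
      refine univSymbol_mem_filtration_of_mem_closure F (mul_mem (Subgroup.subset_closure
        (polyUnit_mem_polyUnitsBelow F hf0 hdf)) (inv_mem (Subgroup.subset_closure (polyUnit_mem_polyUnitsBelow F hg hdg)))) ?_
      rw [hB]
      exact mul_mem (mul_mem (Subgroup.subset_closure (polyUnit_mem_polyUnitsBelow F hg' hdg'))
        (Subgroup.subset_closure (polyUnit_mem_polyUnitsBelow F hg'' hdg'')))
        (inv_mem (Subgroup.subset_closure (polyUnit_mem_polyUnitsBelow F hg hdg)))
    have hπB : univSymbol (polyUnit F π hπ0) B = (univSymbol (polyUnit F f hf0 * (polyUnit F g hg)⁻¹) B)⁻¹ := by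
      rw [hA, hSt.mul_left] at hone
      exact eq_inv_of_mul_eq_one_left hone
    have hmem : univSymbol (polyUnit F π hπ0) B ∈ filtration F d := by rw [hπB]; exact inv_mem hfg
    rw [hB, hSt.mul_right, hSt.mul_right, hSt.inv_right] at hmem
    exact hmem

/-- **«each element ḡ of the quotient F[t]/(π) is represented by a unique polynomial g ∈ F[t] of degree < d»**: a
chosen representative. [cite: Milnor1970, §2 before Lemma 2.4 (p0008 L25–L27)] -/
def hRep (v : HeightOneSpectrum F[X]) (u : (F[X] ⧸ v.asIdeal)ˣ) : F[X] :=
  (exists_residueClassUnit_eq_of_natDegree_lt F v u).choose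

/-- The representative is non-zero. [cite: Milnor1970, §2 before Lemma 2.4 (p0008 L25–L27)] -/
theorem hRep_ne_zero (v : HeightOneSpectrum F[X]) (u : (F[X] ⧸ v.asIdeal)ˣ) : hRep F v u ≠ 0 :=
  (exists_residueClassUnit_eq_of_natDegree_lt F v u).choose_spec.choose

/-- The representative has degree `< d`. [cite: Milnor1970, §2 before Lemma 2.4 (p0008 L25–L27)] -/
theorem natDegree_hRep_lt (v : HeightOneSpectrum F[X]) (u : (F[X] ⧸ v.asIdeal)ˣ) : (hRep F v u).natDegree < primeDeg F v :=
  (exists_residueClassUnit_eq_of_natDegree_lt F v u).choose_spec.choose_spec.choose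

/-- The representative represents `u`. [cite: Milnor1970, §2 before Lemma 2.4 (p0008 L25–L27)] -/
theorem residueClassUnit_hRep (v : HeightOneSpectrum F[X]) (u : (F[X] ⧸ v.asIdeal)ˣ) :
    residueClassUnit F v (hRep F v u) (not_mem_of_natDegree_lt F v (hRep_ne_zero F v u) (natDegree_hRep_lt F v u)) = u :=
  (exists_residueClassUnit_eq_of_natDegree_lt F v u).choose_spec.choose_spec.choose_spec

/-- The class of the representative. [cite: Milnor1970, §2 before Lemma 2.4 (p0008 L25–L27)] -/
theorem mk_hRep (v : HeightOneSpectrum F[X]) (u : (F[X] ⧸ v.asIdeal)ˣ) :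
    Ideal.Quotient.mk v.asIdeal (hRep F v u) = (u : F[X] ⧸ v.asIdeal) := by
  rw [← coe_residueClassUnit F v (hRep F v u) (not_mem_of_natDegree_lt F v (hRep_ne_zero F v u) (natDegree_hRep_lt F v u)),
    residueClassUnit_hRep]

/-- The symbol `c(π, g_u)` of the representative. [cite: Milnor1970, §2 Lemma 2.4 «the residue class of l(π)l(g₂)» (p0008 L30–L32)] -/
def hSymbol (v : HeightOneSpectrum F[X]) (u : (F[X] ⧸ v.asIdeal)ˣ) : UniversalSymbolGroup (RatFunc F) :=
  univSymbol (polyUnit F (monicGen F v) (monicGen_ne_zero F v)) (polyUnit F (hRep F v u) (hRep_ne_zero F v u))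

/-- `hSymbol` is a top generator. [cite: Milnor1970, §2 Lemma 2.4 (p0008 L28–L32)] -/
theorem hSymbol_mem_topPart (v : HeightOneSpectrum F[X]) (u : (F[X] ⧸ v.asIdeal)ˣ) :
    hSymbol F v u ∈ topPart F (primeDeg F v) :=
  univSymbol_mem_topPart F v rfl _ (natDegree_hRep_lt F v u)

/-- **LEMMA 2.4: the homomorphism `h_π : (F[t]/π)• → L_{d+1}/L_d ⊂ U/L_d`, `ḡ ↦ [c(π, g)]`** (`deg π = d + 1`).
[cite: Milnor1970, §2 Lemma 2.4 (p0008 L28 – p0009 L15)] -/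
def hMap {d : ℕ} (v : HeightOneSpectrum F[X]) (hv : primeDeg F v = d + 1) :
    (F[X] ⧸ v.asIdeal)ˣ →* UniversalSymbolGroup (RatFunc F) ⧸ filtration F d where
  toFun u := (hSymbol F v u : UniversalSymbolGroup (RatFunc F) ⧸ filtration F d)
  map_one' := by
    rw [QuotientGroup.eq_one_iff]
    have hlt := natDegree_hRep_lt F v 1
    rw [hv] at hlt
    have h := univSymbol_monicGen_linear_mem_filtration F v hv (hRep_ne_zero F v 1) one_ne_zero one_ne_zero
      (Nat.lt_succ_iff.1 hlt) (by rw [natDegree_one]; exact Nat.zero_le d) (by rw [natDegree_one]; exact Nat.zero_le d)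
      (by rw [mk_hRep, Units.val_one, map_one, mul_one])
    have h1 : polyUnit F (1 : F[X]) one_ne_zero = 1 := Units.ext (by rw [coe_polyUnit, map_one, Units.val_one])
    rw [h1, (isSteinbergSymbol_univSymbol (R := RatFunc F)).one_right, one_mul, one_mul] at h
    exact (Subgroup.inv_mem_iff _).1 h
  map_mul' u₁ u₂ := by
    rw [← QuotientGroup.mk_mul, eq_comm, QuotientGroup.eq]
    have hlt := natDegree_hRep_lt F v (u₁ * u₂)
    have hlt₁ := natDegree_hRep_lt F v u₁
    have hlt₂ := natDegree_hRep_lt F v u₂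
    rw [hv] at hlt hlt₁ hlt₂
    have h := univSymbol_monicGen_linear_mem_filtration F v hv (hRep_ne_zero F v (u₁ * u₂)) (hRep_ne_zero F v u₁)
      (hRep_ne_zero F v u₂) (Nat.lt_succ_iff.1 hlt) (Nat.lt_succ_iff.1 hlt₁) (Nat.lt_succ_iff.1 hlt₂)
      (by rw [mk_hRep, mk_hRep, mk_hRep, Units.val_mul])
    have key : ∀ a b : UniversalSymbolGroup (RatFunc F), a⁻¹ * b = (a * b⁻¹)⁻¹ := fun a b => by
      rw [mul_inv_rev, inv_inv, mul_comm]
    rw [key]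
    exact inv_mem h

/-- **LEMMA 2.4, values**: `h_π(ḡ) = [c(π, g)]` for EVERY non-zero representative `g` of degree `≤ d` (not only the
chosen one) — the map is well defined. [cite: Milnor1970, §2 proof of Lemma 2.4 «(taking y = 1) φ is well defined» (p0009 L11–L15); Milnor1972, §11 proof of Lemma 11.7 (chunk p0067 L41–L43)] -/
theorem hMap_residueClassUnit {d : ℕ} (v : HeightOneSpectrum F[X]) (hv : primeDeg F v = d + 1) {g : F[X]} (hg : g ≠ 0)
    (hdg : g.natDegree ≤ d) :
    hMap F v hv (residueClassUnit F v g (not_mem_of_natDegree_lt F v hg (by rw [hv]; exact Nat.lt_succ_of_le hdg))) =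
      (univSymbol (polyUnit F (monicGen F v) (monicGen_ne_zero F v)) (polyUnit F g hg) :
        UniversalSymbolGroup (RatFunc F) ⧸ filtration F d) := by
  set u := residueClassUnit F v g (not_mem_of_natDegree_lt F v hg (by rw [hv]; exact Nat.lt_succ_of_le hdg)) with hu
  change (hSymbol F v u : UniversalSymbolGroup (RatFunc F) ⧸ filtration F d) = _
  rw [eq_comm, QuotientGroup.eq]
  have hlt := natDegree_hRep_lt F v u
  rw [hv] at hlt
  have h := univSymbol_monicGen_linear_mem_filtration F v hv hg (hRep_ne_zero F v u) one_ne_zero hdg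
    (Nat.lt_succ_iff.1 hlt) (by rw [natDegree_one]; exact Nat.zero_le d)
    (by rw [mk_hRep, map_one, mul_one, hu, coe_residueClassUnit])
  have h1 : polyUnit F (1 : F[X]) one_ne_zero = 1 := Units.ext (by rw [coe_polyUnit, map_one, Units.val_one])
  rw [h1, (isSteinbergSymbol_univSymbol (R := RatFunc F)).one_right, mul_one] at h
  rw [hSymbol, mul_comm]
  exact h

/-- The range of `h_π` is the image of the generators `c(π, g)`, `deg g ≤ d`. [cite: Milnor1970, §2 proof of Lemma 2.5 «belongs to the image of h_π» (p0010 L4–L5)] -/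
theorem mk_univSymbol_mem_range_hMap {d : ℕ} (v : HeightOneSpectrum F[X]) (hv : primeDeg F v = d + 1) {g : F[X]}
    (hg : g ≠ 0) (hdg : g.natDegree ≤ d) :
    (univSymbol (polyUnit F (monicGen F v) (monicGen_ne_zero F v)) (polyUnit F g hg) :
      UniversalSymbolGroup (RatFunc F) ⧸ filtration F d) ∈ (hMap F v hv).range :=
  ⟨_, hMap_residueClassUnit F v hv hg hdg⟩

end Lemma24

/-! ### §3 LEMMA 2.5, generation: `L_{d+1} = L_d · ⟨c(π, g) : deg π = d + 1, deg g ≤ d⟩` -/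

section Lemma25

/-- The atoms: non-zero constants and monic irreducible polynomials of degree `≤ e` («setting f₁ = aπ»).
[cite: Milnor1970, §2 proof of Lemma 2.5 (p0010 L3–L6)] -/
def atomsBelow (e : ℕ) : Set (RatFunc F)ˣ :=
  {x | (∃ (a : F) (ha : a ≠ 0), polyUnit F (C a) (by rwa [Ne, C_eq_zero]) = x) ∨
    (∃ (p : F[X]) (hp : Irreducible p), p.Monic ∧ p.natDegree ≤ e ∧ polyUnit F p hp.ne_zero = x)}

/-- Atoms are polynomials of degree `≤ e`. [cite: Milnor1970, §2 proof of Lemma 2.5 (p0010 L3–L6)] -/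
theorem atomsBelow_subset_polyUnitsBelow (e : ℕ) : atomsBelow F e ⊆ polyUnitsBelow F e := by
  rintro x (⟨a, ha, rfl⟩ | ⟨p, hp, -, hd, rfl⟩)
  · exact polyUnit_mem_polyUnitsBelow F _ (by rw [natDegree_C]; exact Nat.zero_le e)
  · exact polyUnit_mem_polyUnitsBelow F _ hd

/-- **Unique factorisation**: every non-zero polynomial of degree `≤ e` is, as a unit of `F(t)`, a product of atoms of
degree `≤ e` («If f₁ is irreducible, then setting f₁ = aπ … But if f₁ is reducible …»).
[cite: Milnor1970, §2 proof of Lemma 2.5 (p0010 L3–L6)] -/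
theorem polyUnit_mem_closure_atomsBelow (e : ℕ) {f : F[X]} (hf : f ≠ 0) (hd : f.natDegree ≤ e) :
    polyUnit F f hf ∈ Subgroup.closure (atomsBelow F e) := by
  suffices H : ∀ f : F[X], ∀ (hf : f ≠ 0), f.natDegree ≤ e → polyUnit F f hf ∈ Subgroup.closure (atomsBelow F e) from
    H f hf hd
  intro f
  induction f using UniqueFactorizationMonoid.induction_on_prime with
  | h₁ => intro hf; exact absurd rfl hf
  | h₂ u hu =>
    intro hu0 _
    obtain ⟨a, ha, rfl⟩ := Polynomial.isUnit_iff.1 hu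
    have ha0 : a ≠ 0 := ha.ne_zero
    exact Subgroup.subset_closure (Or.inl ⟨a, ha0, rfl⟩)
  | h₃ a p ha0 hp ih =>
    intro hpa hdeg
    have hp0 : p ≠ 0 := hp.ne_zero
    have hdeg' : p.natDegree + a.natDegree ≤ e := by rwa [← natDegree_mul hp0 ha0]
    -- `p = lc(p) · p̃` with `p̃` monic irreducible
    set c : F := p.leadingCoeff with hc
    have hc0 : c ≠ 0 := leadingCoeff_ne_zero.2 hp0
    have hci0 : c⁻¹ ≠ 0 := inv_ne_zero hc0
    have hmonic : (p * C c⁻¹).Monic := monic_mul_leadingCoeff_inv hp0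
    have hirr : Irreducible (p * C c⁻¹) :=
      (irreducible_mul_isUnit (isUnit_C.2 (IsUnit.mk0 _ hci0))).2 hp.irreducible
    have hpeq : p = C c * (p * C c⁻¹) := by
      rw [mul_left_comm, ← map_mul, mul_inv_cancel₀ hc0, map_one, mul_one]
    have hunit : polyUnit F (p * a) hpa =
        polyUnit F (C c) (by rwa [Ne, C_eq_zero]) * polyUnit F (p * C c⁻¹) hirr.ne_zero * polyUnit F a ha0 := by
      refine Units.ext ?_
      simp only [Units.val_mul, coe_polyUnit, ← map_mul]
      rw [← hpeq]
    rw [hunit]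
    refine mul_mem (mul_mem (Subgroup.subset_closure (Or.inl ⟨c, hc0, rfl⟩))
      (Subgroup.subset_closure (Or.inr ⟨_, hirr, hmonic, ?_, rfl⟩))) (ih ha0 (by omega))
    rw [natDegree_mul_leadingCoeff_inv _ hp0]
    omega

/-- The polynomials of degree `≤ e` and the atoms of degree `≤ e` generate the same subgroup of `F(t)•`.
[cite: Milnor1970, §2 proof of Lemma 2.5 (p0010 L3–L6)] -/
theorem closure_polyUnitsBelow_eq_closure_atomsBelow (e : ℕ) :
    Subgroup.closure (polyUnitsBelow F e) = Subgroup.closure (atomsBelow F e) := by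
  refine le_antisymm ((Subgroup.closure_le _).2 ?_) (Subgroup.closure_mono (atomsBelow_subset_polyUnitsBelow F e))
  rintro x ⟨f, hf, hd, rfl⟩
  exact polyUnit_mem_closure_atomsBelow F e hf hd

/-- `−1 ∈ F(t)•` is the constant polynomial `C(−1)`. [cite: Milnor1970, §2 proof of Lemma 2.5 (p0009 L35–L37)] -/
theorem polyUnit_C_neg_one : polyUnit F (C (-1 : F)) (by rw [Ne, C_eq_zero]; exact neg_ne_zero.2 one_ne_zero) = -1 :=
  Units.ext (by simp only [coe_polyUnit, map_neg, map_one, Units.val_neg, Units.val_one])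

/-- **The five-term identity** («f₂ = −af₁ + g … af₁/g + f₂/g = 1 hence (l(a) + l(f₁) − l(g))(l(f₂) − l(g)) = 0.
Thus the product l(f₁)l(f₂) can be expressed as a sum of terms l(f₁)l(g) + l(g)l(f₂) − l(a)l(f₂) + l(a)l(g) − l(g)²,
each of which involves at most one polynomial of degree d»), here for two DISTINCT monic irreducible `p, q` of degree
`d + 1` (`a = −1`, `g = q − p`): `c(q, p) ∈ L_d ⊔ topPart (d+1)`. [cite: Milnor1970, §2 proof of Lemma 2.5 (p0009 L31 – p0010 L2)] -/
theorem univSymbol_monic_irreducible_mem {d : ℕ} {p q : F[X]} (hp : Irreducible p) (hq : Irreducible q) (hpm : p.Monic)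
    (hqm : q.Monic) (hdp : p.natDegree = d + 1) (hdq : q.natDegree = d + 1) (hpq : p ≠ q) :
    univSymbol (polyUnit F q hq.ne_zero) (polyUnit F p hp.ne_zero) ∈ filtration F d ⊔ topPart F (d + 1) := by
  have hSt := isSteinbergSymbol_univSymbol (R := RatFunc F)
  set M := filtration F d ⊔ topPart F (d + 1) with hM
  -- `r = q − p ≠ 0` of degree `≤ d`
  have hr0 : q - p ≠ 0 := sub_ne_zero.2 (Ne.symm hpq)
  have hdr : (q - p).natDegree ≤ d := by
    have hdeg : q.degree = p.degree := by
      rw [degree_eq_natDegree hq.ne_zero, degree_eq_natDegree hp.ne_zero, hdq, hdp]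
    have hlt : (q - p).degree < q.degree := degree_sub_lt hdeg hq.ne_zero (by rw [hqm.leadingCoeff, hpm.leadingCoeff])
    rw [degree_eq_natDegree hq.ne_zero, degree_eq_natDegree hr0, hdq] at hlt
    exact Nat.lt_succ_iff.1 (by exact_mod_cast hlt)
  -- the primes of `p`, `q`
  set vp := primeOf F p hp with hvp
  set vq := primeOf F q hq with hvq
  have hgp : monicGen F vp = p := monicGen_primeOf F p hpm hp
  have hgq : monicGen F vq = q := monicGen_primeOf F q hqm hq
  have hdvp : primeDeg F vp = d + 1 := by rw [primeDeg, hgp, hdp]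
  have hdvq : primeDeg F vq = d + 1 := by rw [primeDeg, hgq, hdq]
  have hπp : polyUnit F p hp.ne_zero = polyUnit F (monicGen F vp) (monicGen_ne_zero F vp) :=
    Units.ext (by simp only [coe_polyUnit, hgp])
  have hπq : polyUnit F q hq.ne_zero = polyUnit F (monicGen F vq) (monicGen_ne_zero F vq) :=
    Units.ext (by simp only [coe_polyUnit, hgq])
  -- membership of the five factors
  have hneg1 : (-1 : (RatFunc F)ˣ) = polyUnit F (C (-1 : F)) (by rw [Ne, C_eq_zero]; exact neg_ne_zero.2 one_ne_zero) :=
    (polyUnit_C_neg_one F).symm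
  have hle1 : filtration F d ≤ M := le_sup_left
  have hle2 : topPart F (d + 1) ≤ M := le_sup_right
  have m1 : univSymbol (polyUnit F q hq.ne_zero) (-1) ∈ M := by
    rw [hπq, hneg1]
    exact hle2 (univSymbol_mem_topPart F vq hdvq _ (by rw [natDegree_C]; exact Nat.succ_pos d))
  have m2 : univSymbol (polyUnit F q hq.ne_zero) (polyUnit F (q - p) hr0) ∈ M := by
    rw [hπq]
    exact hle2 (univSymbol_mem_topPart F vq hdvq _ (Nat.lt_succ_of_le hdr))
  have m3 : univSymbol (polyUnit F (q - p) hr0) (-1) ∈ M := by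
    rw [hneg1]
    exact hle1 (univSymbol_polyUnit_mem_filtration F hr0 _ hdr (by rw [natDegree_C]; exact Nat.zero_le d))
  have m4 : univSymbol (polyUnit F (q - p) hr0) (polyUnit F p hp.ne_zero) ∈ M := by
    rw [hπp, hSt.symm]
    exact inv_mem (hle2 (univSymbol_mem_topPart F vp hdvp _ (Nat.lt_succ_of_le hdr)))
  have m5 : univSymbol (polyUnit F (q - p) hr0) (polyUnit F (q - p) hr0) ∈ M :=
    hle1 (univSymbol_polyUnit_mem_filtration F hr0 hr0 hdr hdr)
  -- the relation `q/r + (−p/r) = 1`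
  set Q : (RatFunc F)ˣ := polyUnit F q hq.ne_zero with hQ
  set P : (RatFunc F)ˣ := polyUnit F p hp.ne_zero with hP
  set Rr : (RatFunc F)ˣ := polyUnit F (q - p) hr0 with hRr
  have hrel : ((Q * Rr⁻¹ : (RatFunc F)ˣ) : RatFunc F) + (-(P * Rr⁻¹) : (RatFunc F)ˣ) = 1 := by
    have hra : algebraMap F[X] (RatFunc F) (q - p) ≠ 0 := Rr.ne_zero
    rw [Units.val_neg, Units.val_mul, Units.val_mul, Units.val_inv_eq_inv_val, hQ, hP, hRr]
    simp only [coe_polyUnit]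
    rw [← sub_eq_add_neg, ← sub_mul, ← map_sub, mul_inv_cancel₀ hra]
  have hone := hSt.eq_one_of_add_eq_one _ _ hrel
  -- expand: c(Q R⁻¹, −P R⁻¹) = c(Q, −P R⁻¹) c(R⁻¹, −P R⁻¹)
  rw [hSt.mul_left, hSt.inv_left, neg_mul_eq_neg_mul, ← neg_one_mul, mul_assoc, hSt.mul_right, hSt.mul_right,
    hSt.mul_right, hSt.mul_right, hSt.inv_right, hSt.inv_right, mul_inv_eq_one] at hone
  -- hone : c(Q,−1) (c(Q,P) c(Q,R)⁻¹) = c(R,−1) (c(R,P) c(R,R)⁻¹)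
  have hQP : univSymbol Q P = (univSymbol Q (-1))⁻¹ * univSymbol Q Rr * (univSymbol Rr (-1) * (univSymbol Rr P *
      (univSymbol Rr Rr)⁻¹)) := by
    rw [← hone, mul_assoc (univSymbol Q (-1))⁻¹, mul_left_comm (univSymbol Q Rr) (univSymbol Q (-1)),
      inv_mul_cancel_left, mul_left_comm, mul_inv_cancel, mul_one]
  rw [hQP]
  exact mul_mem (mul_mem (inv_mem m1) m2) (mul_mem m3 (mul_mem m4 (inv_mem m5)))

/-- **LEMMA 2.5, the case analysis on two atoms**: for atoms `s, t` of degree `≤ d + 1`, `c(s, t) ∈ L_d ⊔ topPart (d+1)`.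
[cite: Milnor1970, §2 proof of Lemma 2.5 (p0009 L31 – p0010 L6)] -/
theorem univSymbol_atoms_mem {d : ℕ} {s t : (RatFunc F)ˣ} (hs : s ∈ atomsBelow F (d + 1)) (ht : t ∈ atomsBelow F (d + 1)) :
    univSymbol s t ∈ filtration F d ⊔ topPart F (d + 1) := by
  have hSt := isSteinbergSymbol_univSymbol (R := RatFunc F)
  have hle1 : filtration F d ≤ filtration F d ⊔ topPart F (d + 1) := le_sup_left
  have hle2 : topPart F (d + 1) ≤ filtration F d ⊔ topPart F (d + 1) := le_sup_right
  -- an atom is either of degree `≤ d` or a monic irreducible of degree exactly `d + 1`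
  have hsplit : ∀ {x : (RatFunc F)ˣ}, x ∈ atomsBelow F (d + 1) →
      x ∈ polyUnitsBelow F d ∨ ∃ (v : HeightOneSpectrum F[X]), primeDeg F v = d + 1 ∧
        polyUnit F (monicGen F v) (monicGen_ne_zero F v) = x := by
    rintro x (⟨a, ha, rfl⟩ | ⟨p, hp, hm, hdp, rfl⟩)
    · exact Or.inl (polyUnit_mem_polyUnitsBelow F _ (by rw [natDegree_C]; exact Nat.zero_le d))
    · rcases Nat.lt_or_ge p.natDegree (d + 1) with hlt | hge
      · exact Or.inl (polyUnit_mem_polyUnitsBelow F _ (Nat.lt_succ_iff.1 hlt))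
      · refine Or.inr ⟨primeOf F p hp, ?_, Units.ext (by simp only [coe_polyUnit, monicGen_primeOf F p hm hp])⟩
        rw [primeDeg, monicGen_primeOf F p hm hp]
        exact le_antisymm hdp hge
  rcases hsplit hs with hs' | ⟨v, hv, rfl⟩ <;> rcases hsplit ht with ht' | ⟨w, hw, rfl⟩
  · exact hle1 (univSymbol_mem_filtration F hs' ht')
  · obtain ⟨g, hg, hdg, rfl⟩ := hs'
    rw [hSt.symm]
    exact inv_mem (hle2 (univSymbol_mem_topPart F w hw hg (Nat.lt_succ_of_le hdg)))
  · obtain ⟨g, hg, hdg, rfl⟩ := ht'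
    exact hle2 (univSymbol_mem_topPart F v hv hg (Nat.lt_succ_of_le hdg))
  · by_cases hvw : v = w
    · subst hvw
      rw [hSt.self_eq_neg_one, ← polyUnit_C_neg_one]
      exact hle2 (univSymbol_mem_topPart F v hv _ (by rw [natDegree_C]; exact Nat.succ_pos d))
    · have hne : monicGen F w ≠ monicGen F v := fun h => hvw (by
        rw [← primeOf_monicGen F v, ← primeOf_monicGen F w]; exact HeightOneSpectrum.ext (by
          change Ideal.span {monicGen F v} = Ideal.span {monicGen F w}; rw [h]))
      have key := univSymbol_monic_irreducible_mem F (irreducible_monicGen F w) (irreducible_monicGen F v)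
        (monic_monicGen F w) (monic_monicGen F v) hw hv hne
      exact key

/-- **LEMMA 2.5, generation: `L_{d+1} ≤ L_d ⊔ ⟨c(π, g) : deg π = d + 1, deg g ≤ d⟩`** («Thus L_d/L_{d−1} is generated
by the images of the homomorphisms h_π»). [cite: Milnor1970, §2 proof of Lemma 2.5 (p0009 L31 – p0010 L8)] -/
theorem filtration_succ_le (d : ℕ) : filtration F (d + 1) ≤ filtration F d ⊔ topPart F (d + 1) := by
  rw [filtration, Subgroup.closure_le]
  rintro u ⟨x, hx, y, hy, rfl⟩
  have hx' : x ∈ Subgroup.closure (atomsBelow F (d + 1)) := by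
    rw [← closure_polyUnitsBelow_eq_closure_atomsBelow]; exact Subgroup.subset_closure hx
  have hy' : y ∈ Subgroup.closure (atomsBelow F (d + 1)) := by
    rw [← closure_polyUnitsBelow_eq_closure_atomsBelow]; exact Subgroup.subset_closure hy
  exact (isSteinbergSymbol_univSymbol (R := RatFunc F)).mem_of_mem_closure
    (fun s hs t ht => univSymbol_atoms_mem F hs ht) hx' hy'

/-- `L_{d+1} = L_d ⊔ topPart (d+1)`. [cite: Milnor1970, §2 proof of Lemma 2.5 (p0010 L6–L8)] -/
theorem filtration_succ_eq (d : ℕ) : filtration F (d + 1) = filtration F d ⊔ topPart F (d + 1) :=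
  le_antisymm (filtration_succ_le F d) (sup_le (filtration_mono F (Nat.le_succ d)) (topPart_le_filtration F d))

end Lemma25

/-! ### §4 «each ∂_π induces a homomorphism L_d/L_{d−1} → K_{n−1}F[t]/(π)»: tame symbols on the filtration -/

section Tame

/-- **`∂_𝔭(L_d) = 1` for `deg 𝔭 > d`**: the tame symbol at a prime of degree `> d` kills `L_d` (all polynomials of
degree `≤ d` are `𝔭`-units). [cite: Milnor1970, §2 proof of Lemma 2.5 «Inspection shows» (p0009 L26–L27); Milnor1972, §11 proof of Theorem 11.6 «this homomorphism annihilates L_{p−1}» (chunk p0067 L28–L29)] -/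
theorem tameHomQuot_apply_eq_one_of_mem_filtration {d : ℕ} {u : UniversalSymbolGroup (RatFunc F)}
    (hu : u ∈ filtration F d) (w : HeightOneSpectrum F[X]) (hw : d < primeDeg F w) :
    (tameHomQuot F[X] (RatFunc F) u : (w : HeightOneSpectrum F[X]) → (F[X] ⧸ w.asIdeal)ˣ) w = 1 := by
  -- evaluation at `w` composed with `tameHomQuot` is a homomorphism whose kernel contains the generators
  set ev : UniversalSymbolGroup (RatFunc F) →* (F[X] ⧸ w.asIdeal)ˣ :=
    (Pi.evalMonoidHom (fun w' : HeightOneSpectrum F[X] => (F[X] ⧸ w'.asIdeal)ˣ) w).comp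
      ((Subgroup.subtype _).comp (tameHomQuot F[X] (RatFunc F))) with hev
  have hgen : filtration F d ≤ ev.ker := by
    rw [filtration, Subgroup.closure_le]
    rintro u ⟨x, ⟨f, hf, hdf, rfl⟩, y, ⟨g, hg, hdg, rfl⟩, rfl⟩
    rw [SetLike.mem_coe, MonoidHom.mem_ker, hev, MonoidHom.comp_apply, MonoidHom.comp_apply, Subgroup.coe_subtype,
      Pi.evalMonoidHom_apply, tameHomQuot_univSymbol_apply]
    exact quotTameSymbol_polyUnit_of_not_mem F w hf hg (not_mem_of_natDegree_lt F w hf (lt_of_le_of_lt hdf hw))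
      (not_mem_of_natDegree_lt F w hg (lt_of_le_of_lt hdg hw))
  have := hgen hu
  rwa [MonoidHom.mem_ker] at this

/-- **`∂_𝔭 c(π_𝔭, g) = ḡ⁻¹`** for `g ∉ 𝔭` («the composition ∂ ∘ h_π is the identity» up to the sign convention of the
tame symbol `(x, u)_𝔭 = (ū^{v(x)})⁻¹`). [cite: Milnor1970, §2 proof of Lemma 2.5 (p0009 L27–L30); Milnor1972, §11 Lemma 11.5 (chunk p0064 L37)] -/
theorem tameHomQuot_monicGen_polyUnit_self (v : HeightOneSpectrum F[X]) {g : F[X]} (hg : g ≠ 0) (hgv : g ∉ v.asIdeal) :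
    (tameHomQuot F[X] (RatFunc F) (univSymbol (polyUnit F (monicGen F v) (monicGen_ne_zero F v)) (polyUnit F g hg)) :
      (w : HeightOneSpectrum F[X]) → (F[X] ⧸ w.asIdeal)ˣ) v = (residueClassUnit F v g hgv)⁻¹ := by
  rw [tameHomQuot_univSymbol_apply, (isSteinbergSymbol_quotTameSymbol F[X] (RatFunc F) v).symm,
    quotTameSymbol_polyUnit_monicGen_self F v hg hgv]

/-- **`∂_{𝔭′} c(π_𝔭, g) = 1`** for `𝔭′ ≠ 𝔭` with `g ∉ 𝔭′` («or zero, according as π ≠ π′»).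
[cite: Milnor1970, §2 proof of Lemma 2.5 (p0009 L27–L30)] -/
theorem tameHomQuot_monicGen_polyUnit_of_ne {v w : HeightOneSpectrum F[X]} (hvw : v ≠ w) {g : F[X]} (hg : g ≠ 0)
    (hgw : g ∉ w.asIdeal) :
    (tameHomQuot F[X] (RatFunc F) (univSymbol (polyUnit F (monicGen F v) (monicGen_ne_zero F v)) (polyUnit F g hg)) :
      (w : HeightOneSpectrum F[X]) → (F[X] ⧸ w.asIdeal)ˣ) w = 1 := by
  rw [tameHomQuot_univSymbol_apply, (isSteinbergSymbol_quotTameSymbol F[X] (RatFunc F) w).symm,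
    quotTameSymbol_polyUnit_monicGen_of_not_mem F hvw hg hgw, inv_one]

/-- The leading-coefficient symbol kills the generators `c(π, g)` (`π` monic: `{lead coef π, lead coef g} = {1, ·} = 1`),
hence all of `topPart`. [cite: Milnor1972, §11 Remark before Theorem 11.10 «c(f,g) = {lead coef f, lead coef g}» (chunk p0070 L1–L4)] -/
theorem lcSymbolHom_eq_one_of_mem_topPart {d : ℕ} {u : UniversalSymbolGroup (RatFunc F)} (hu : u ∈ topPart F d) :
    lcSymbolHom F u = 1 := by
  have hgen : topPart F d ≤ (lcSymbolHom F).ker := by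
    rw [topPart, Subgroup.closure_le]
    rintro u ⟨v, g, hg, -, -, rfl⟩
    rw [SetLike.mem_coe, MonoidHom.mem_ker, lcSymbolHom_univSymbol]
    have h1 : lcUnit F (polyUnit F (monicGen F v) (monicGen_ne_zero F v)) = 1 :=
      Units.ext (by rw [coe_lcUnit, coe_polyUnit, lcRat_algebraMap, (monic_monicGen F v).leadingCoeff, Units.val_one])
    rw [h1, (isSteinbergSymbol_univSymbol (R := F)).one_left]
  have := hgen hu
  rwa [MonoidHom.mem_ker] at this

end Tame

end Literature.RingTheory.KTheory
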